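import Summits.KontsevichZagierPeriods.KontsevichZagierPeriods.Theorems.RootDecompRelativeModAbsoluteEvenCircleP5

/-! # `RootDecompRelativeModAbsoluteEvenCircleP6` — part 6/10 of the mechanical ≤400-line split of `evB_src3.lean` (sha256 9b9fc462830f2800…)
Source: decomp-kz lens-3 g14 EvenCircle.lean FINAL @ba0f3b57 §K0–§K12 (land/EvenCircleB @954ab641, lint-fixed, §K12 re-pointed at the landed CircleSplit names; critic CLEARED g7-2 l.1388: evenCircleCellClose_holds); --supports stmt-KontsevichZagierPeriods-30572.
Split by census-1 g10 `gen/splitlean.py`: scopes re-opened with their `open`/`variable`/`set_option` context; mathematics and declaration order unchanged. -/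

noncomputable section
open Set MeasureTheory
open Literature.NumberTheory.Transcendental Literature.ModelTheory.ExponentialFields
namespace Summit.KontsevichZagierPeriods.RootDecompRelativeModAbsolute.Rung30571.RegularisedLogLayer.CylLog.Leaf.G13
namespace AngleFold

open Filter Topology in
/-- **Half-cell fold for even circle kernels (PROVED).**  On an open order-convex `ℚ`-sa cell `T ⊂ ℝ` with finite top end
`β`, let `A_j = ⟦band T 0 u_j; p_j g_{n_j}⟧` (honest), `A₀ = ⟦T; a₀⟧`, with each `u_j ≥ 0` sa, differentiable, of constant
monotonicity type and on one side of `1`, `p_j G_{n_j}(u_j) ∈ L¹(T)`, `p_j` integrable on bottom segments, the pointwise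
identity `a₀ + Σ_j p_j Q_{n_j}(u_j) = 0`, and integer angle relations `Σ_j f'_{sj} arctan u_j = m_s π` with
`(−1)^{n_j} p_j = Σ_s q'_s f'_{sj}`, `Σ_s q'_s m_s = 0`.  Then `[A₀] + Σ_j [A_j]` is a relation. -/
theorem half_top_even {T : Set (Fin 1 → ℝ)} (hT : IsSemialgebraic ℚ T) (hTo : IsOpen T) (hTc : OrdConv T)
    (hne : T.Nonempty) {β : ℝ} (hβ : IsLUB (bpt ⁻¹' T) β) {l : ℕ} (nn : Fin l → ℕ) {p u : Fin l → (Fin 1 → ℝ) → ℝ}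
    (hp : ∀ j, IsSemialgebraicFunOn ℚ T (p j)) (hu : ∀ j, IsSemialgebraicFunOn ℚ T (u j))
    (hu0 : ∀ j, ∀ x ∈ T, 0 ≤ u j x) (hud : ∀ j, ∀ x ∈ T, DifferentiableAt ℝ (u j) x)
    (hsgn : ∀ j, (∀ x ∈ T, du (u j) x = 0) ∨ (∀ x ∈ T, du (u j) x < 0) ∨ (∀ x ∈ T, 0 < du (u j) x))
    (hone : ∀ j, (∀ x ∈ T, u j x ≤ 1) ∨ (∀ x ∈ T, 1 ≤ u j x))
    (A : Fin l → KZ.IntegralRep 2) (hAd : ∀ j, (A j).domain = KZlog.band T (fun _ => 0) (u j))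
    (hAi : ∀ j, EqOn (A j).integrand (fun z => p j (Fin.init z) * gk (nn j) (z (Fin.last 1))) (A j).domain)
    (hint : ∀ j, IntegrableOn (fun x => p j x * Gn (nn j) (u j x)) T)
    (hloc : ∀ j, ∀ x₁ ∈ T, IntegrableOn (p j) {x | x ∈ T ∧ x 0 ≤ x₁ 0})
    (A₀ : KZ.IntegralRep 1) (hA₀d : A₀.domain = T) {a₀ : (Fin 1 → ℝ) → ℝ} (hA₀i : EqOn A₀.integrand a₀ T)
    (hzero : ∀ x ∈ T, a₀ x + ∑ j, p j x * Qk (nn j) (u j x) = 0)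
    {S : ℕ} (f' : Fin S → Fin l → ℤ) (m : Fin S → ℚ) (q' : Fin S → (Fin 1 → ℝ) → ℝ)
    (hrel : ∀ s, ∀ x ∈ T, ∑ j, (f' s j : ℝ) * Real.arctan (u j x) = (m s : ℝ) * Real.pi)
    (hbud : ∀ x ∈ T, ∑ s, q' s x * (m s : ℝ) = 0)
    (hpq : ∀ j, ∀ x ∈ T, (-1) ^ (nn j) * p j x = ∑ s, q' s x * (f' s j : ℝ)) :
    KZ.of A₀ + ∑ j, KZ.of (A j) ∈ KZ.relations := by
  classical
  have hTm : MeasurableSet T := IsSemialgebraic.measurableSet_holds hT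
  have hRsa : IsSemialgebraic ℚ (Rgn T) := isSemialgebraic_Rgn hT
  have hRm : MeasurableSet (Rgn T) := IsSemialgebraic.measurableSet_holds hRsa
  obtain ⟨x₂, hx₂⟩ := hne
  have hpt : ∀ j, IsSemialgebraicFunOn ℚ T (fun x => (-1) ^ (nn j) * p j x) := fun j => sa_signMul hT (hp j) (nn j)
  choose d ε K dv cv V W R hd0 hds hε hKd hKi hdv0 hdvs hVd hVi hWd hWi hRd hRi hclA happr hlim hpL hεd using
    fun j => edge_package_circ hT hTo hTc ⟨x₂, hx₂⟩ (nn j) (hp j) (hu j) (hu0 j) (hud j) (hsgn j) (hone j) (A j)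
      (hAd j) (hAi j) (hint j) (hloc j)
  have hltβ : ∀ x ∈ T, x 0 < β := fun x hx => lt_of_isLUB hTo hβ hx
  have hIoo : ∀ x ∈ T, Ioo (x 0) β ⊆ bpt ⁻¹' T := fun x hx => Ioo_subset_of_isLUB hTc hβ hx
  -- `ε_j Q(d_j) = Q(d_j)` and `ε_j arctan d_j = arctan d_j`
  have hεQ : ∀ j, ε j * Qk (nn j) (d j) = Qk (nn j) (d j) := fun j => by
    rcases hε j with h | h
    · rw [h, hεd j h, Qk_zero_right, mul_zero]
    · rw [h, one_mul]
  have hεA : ∀ j, ε j * Real.arctan (d j) = Real.arctan (d j) := fun j => by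
    rcases hε j with h | h
    · rw [h, hεd j h, Real.arctan_zero, mul_zero]
    · rw [h, one_mul]
  -- integrability gadgets on `T`
  have ha₀ : IntegrableOn a₀ T := by
    have h := A₀.integrableOn; rw [hA₀d] at h; exact h.congr_fun hA₀i hTm
  have hRint : ∀ j, IntegrableOn (fun x => (1 - ε j) * (p j x * Qk (nn j) (u j x))) T := fun j => by
    have h := (R j).integrableOn; rw [hRd j] at h; exact h.congr_fun (hRi j) hTm
  have hKQ : ∀ j, IntegrableOn (fun x => p j x * Qk (nn j) (d j)) T := fun j => by
    rcases (hd0 j).eq_or_lt with h | h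
    · rw [← h, Qk_zero_right]; simp only [mul_zero]; exact integrableOn_zero
    · exact (hpL j h).mul_const _
  have hKG : ∀ j, IntegrableOn (fun x => p j x * Gn (nn j) (d j)) T := fun j => by
    rcases (hd0 j).eq_or_lt with h | h
    · rw [← h, Gn_zero_right]; simp only [mul_zero]; exact integrableOn_zero
    · exact (hpL j h).mul_const _
  have hKa : ∀ j, IntegrableOn (fun x => p j x * Real.arctan (d j)) T := fun j => by
    rcases (hd0 j).eq_or_lt with h | h
    · rw [← h, Real.arctan_zero]; simp only [mul_zero]; exact integrableOn_zero
    · exact (hpL j h).mul_const _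
  have hKa' : ∀ j, IntegrableOn (fun x => (-1) ^ (nn j) * p j x * Real.arctan (d j)) T := fun j =>
    IntegrableOn.congr_fun ((hKa j).const_mul ((-1) ^ (nn j))) (fun x _ => by ring) hTm
  -- (1) the total Jacobian rep and ONE Newton–Leibniz
  have hsumW : ∀ z ∈ Rgn T, ∑ j, (W j).integrand z =
      ∑ j, (ε j * p j (Fin.init z)) * qk (nn j) (u j (bpt (z (Fin.last 1)))) * du (u j) (bpt (z (Fin.last 1))) := by
    intro z hz
    have h0 := sum_wfun_eq_zero hTo hud f' m q' hrel (p := fun j x => (-1) ^ (nn j) * p j x) hpq z hz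
    calc ∑ j, (W j).integrand z = ∑ j, (ε j * (p j (Fin.init z) * qk (nn j) (u j (bpt (z (Fin.last 1)))) *
          du (u j) (bpt (z (Fin.last 1)))) + wfun (fun x => (-1) ^ (nn j) * p j x) (u j) z) :=
          Finset.sum_congr rfl fun j _ => hWi j (by rw [hWd j]; exact hz)
      _ = ∑ j, ε j * (p j (Fin.init z) * qk (nn j) (u j (bpt (z (Fin.last 1)))) * du (u j) (bpt (z (Fin.last 1)))) +
          ∑ j, wfun (fun x => (-1) ^ (nn j) * p j x) (u j) z := Finset.sum_add_distrib
      _ = _ := by rw [h0, add_zero]; exact Finset.sum_congr rfl fun j _ => by ring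
  have hWt_sa : IsSemialgebraicFunOn ℚ (Rgn T) (fun z => ∑ j, (W j).integrand z) :=
    KZ.isSemialgebraicFunOn_finset_sum Finset.univ hRsa fun j _ => by
      have h := (W j).isSemialgebraicFunOn_integrand; rw [hWd j] at h; exact h
  have hWt_int : IntegrableOn (fun z => ∑ j, (W j).integrand z) (Rgn T) :=
    MeasureTheory.integrable_finsetSum _ fun j _ => by have h := (W j).integrableOn; rw [hWd j] at h; exact h
  let Wt : KZ.IntegralRep 2 := ⟨Rgn T, fun z => ∑ j, (W j).integrand z, hRsa, hWt_sa, hWt_int⟩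
  have hWt : ∑ j, cl (W j) = cl Wt := by
    obtain ⟨Z, hZd, hZi⟩ := KZ.exists_zeroRep hRsa
    have h := KZ.of_sub_of_sub_sum_mem_relations l Wt Z W hZd (fun j => hWd j) fun z _ => by
      show ∑ j, (W j).integrand z = Z.integrand z + ∑ i, (W i).integrand z
      rw [hZi, Pi.zero_apply, zero_add]
    have hZ : cl Z = 0 := cl_eq_zero_of_eqOn_zero Z (by rw [hZi]; exact fun _ _ => rfl)
    rw [sub_sub] at h
    have e := mk_sub_eq h
    rw [map_add, map_sum] at e
    show ∑ j, mk (KZ.of (W j)) = mk (KZ.of Wt)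
    rw [e, show mk (KZ.of Z) = 0 from hZ, zero_add]
  have hpε : ∀ j, IsSemialgebraicFunOn ℚ T (fun x => ε j * p j x) := fun j => by
    rcases hε j with h | h
    · exact (saConst_zero hT).congr fun x _ => by simp [h]
    · exact (hp j).congr fun x _ => by simp [h]
  have hlimN : ∀ j, (∀ x ∈ T, ε j * p j x = 0) ∨ Tendsto (fun s => u j (bpt s)) (𝓝[<] β) (𝓝 (d j)) := fun j => by
    rcases hε j with h | h
    · exact Or.inl fun x _ => by rw [h, zero_mul]
    · refine Or.inr (Metric.tendsto_nhds.2 fun δ hδ => ?_)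
      obtain ⟨x₁, hx₁, hx⟩ := happr j h δ hδ
      filter_upwards [Ioo_mem_nhdsLT (hltβ x₁ hx₁)] with s hs
      rw [Real.dist_eq]
      exact hx (bpt s) (hIoo x₁ hx₁ hs) (by rw [bpt_apply]; exact hs.1.le)
  -- the Newton rep `RN = ⟦T; Σ_j ε_j p_j (Q(d_j) − Q(u_j))⟧`, honest by the pointwise identity
  have hRN_sa : IsSemialgebraicFunOn ℚ T (fun x => ∑ j, ε j * p j x * (Qk (nn j) (d j) - Qk (nn j) (u j x))) :=
    KZ.isSemialgebraicFunOn_finset_sum Finset.univ hT fun j _ =>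
      (hpε j).mul_holds (IsSemialgebraicFunOn.sub_holds (sa_Qk hT (hds j) (nn j)) (sa_Qk hT (hu j) (nn j)))
  have hRN_int : IntegrableOn (fun x => ∑ j, ε j * p j x * (Qk (nn j) (d j) - Qk (nn j) (u j x))) T := by
    have h1 : IntegrableOn (fun x => (∑ j, p j x * Qk (nn j) (d j)) + a₀ x +
        ∑ j, (1 - ε j) * (p j x * Qk (nn j) (u j x))) T :=
      ((MeasureTheory.integrable_finsetSum _ fun j _ => hKQ j).add ha₀).add (MeasureTheory.integrable_finsetSum _ fun j _ => hRint j)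
    refine h1.congr_fun (fun x hx => ?_) hTm
    have ha : a₀ x = -∑ j, p j x * Qk (nn j) (u j x) := by linarith [hzero x hx]
    dsimp only
    rw [ha, ← Finset.sum_neg_distrib, ← Finset.sum_add_distrib, ← Finset.sum_add_distrib]
    refine Finset.sum_congr rfl fun j _ => ?_
    have := hεQ j
    linear_combination (-(p j x)) * this
  let RN : KZ.IntegralRep 1 := ⟨T, fun x => ∑ j, ε j * p j x * (Qk (nn j) (d j) - Qk (nn j) (u j x)), hT, hRN_sa, hRN_int⟩
  have rN : KZ.of Wt - KZ.of RN ∈ KZ.relations :=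
    rgn_newton hT hTo hTc ⟨x₂, hx₂⟩ hβ nn (p := fun j x => ε j * p j x) d hpε hu hud hds hlimN Wt rfl
      (fun z hz => hsumW z hz) RN rfl fun x _ => rfl
  have eN : cl Wt = cl RN := mk_sub_eq rN
  -- (2) the limiting constant angle relation
  have hrel' : ∀ s, ∑ i : Fin l ⊕ Fin l × Fin 3,
      ((Sum.elim (f' s) (fun jk : Fin l × Fin 3 => cv jk.1 jk.2 * f' s jk.1) i : ℤ) : ℝ) *
        Real.arctan (Sum.elim d (fun jk : Fin l × Fin 3 => dv jk.1 jk.2) i) = (m s : ℝ) * Real.pi := by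
    intro s
    set θ : Fin l → ℝ := fun j => ε j * Real.arctan (d j) + ∑ k, (cv j k : ℝ) * Real.arctan (dv j k) with hθ
    have hL : ∑ i : Fin l ⊕ Fin l × Fin 3,
        ((Sum.elim (f' s) (fun jk : Fin l × Fin 3 => cv jk.1 jk.2 * f' s jk.1) i : ℤ) : ℝ) *
          Real.arctan (Sum.elim d (fun jk : Fin l × Fin 3 => dv jk.1 jk.2) i) = ∑ j, (f' s j : ℝ) * θ j := by
      rw [Fintype.sum_sum_type, Fintype.sum_prod_type, ← Finset.sum_add_distrib]
      refine Finset.sum_congr rfl fun j _ => ?_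
      simp only [Sum.elim_inl, Sum.elim_inr, hθ, hεA]
      rw [mul_add, Finset.mul_sum]
      refine congrArg _ (Finset.sum_congr rfl fun k _ => by push_cast; ring)
    rw [hL]
    symm
    refine eq_of_forall_abs_sub_le (C := ∑ j, |(f' s j : ℝ)|) (Finset.sum_nonneg fun j _ => abs_nonneg _)
      fun δ hδ => ?_
    choose x₁ hx₁T hx₁ using fun j => hlim j δ hδ
    obtain ⟨xm, hxmT, hxm⟩ : ∃ xm ∈ T, ∀ j, x₁ j 0 ≤ xm 0 := by
      rcases isEmpty_or_nonempty (Fin l) with hl | hl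
      · exact ⟨x₂, hx₂, fun j => (IsEmpty.false j).elim⟩
      · obtain ⟨j₀, -, hj₀⟩ := Finset.exists_max_image Finset.univ (fun j => x₁ j 0) Finset.univ_nonempty
        exact ⟨x₁ j₀, hx₁T j₀, fun j => hj₀ j (Finset.mem_univ j)⟩
    have h1 := hrel s xm hxmT
    calc |(m s : ℝ) * Real.pi - ∑ j, (f' s j : ℝ) * θ j|
          = |∑ j, (f' s j : ℝ) * (Real.arctan (u j xm) - θ j)| := by
            rw [← h1, ← Finset.sum_sub_distrib]
            exact congrArg _ (Finset.sum_congr rfl fun j _ => by ring)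
      _ ≤ ∑ j, |(f' s j : ℝ) * (Real.arctan (u j xm) - θ j)| := Finset.abs_sum_le_sum_abs _ _
      _ ≤ ∑ j, |(f' s j : ℝ)| * δ := Finset.sum_le_sum fun j _ => by
            rw [abs_mul]
            exact mul_le_mul_of_nonneg_left (hx₁ j xm hxmT (hxm j)).le (abs_nonneg _)
      _ = (∑ j, |(f' s j : ℝ)|) * δ := by rw [Finset.sum_mul]
  -- (3) the constant circle bands: division + rule 3 in `s`
  let Kq : Fin l → KZ.IntegralRep 2 := fun j => polyRep hT (hds j) (hp j) (nn j) (fun _ _ => hd0 j) (hKG j) (hKa j)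
  let Ka : Fin l → KZ.IntegralRep 2 := fun j => arctanRep hT (hds j) (hpt j) (fun _ _ => hd0 j) (hKa' j)
  have eK : ∀ j, cl (K j) = cl (Kq j) + cl (Ka j) := fun j => by
    have h := circ_kernel_split (nn j) (K j) (Kq j) (Ka j) (by rw [hKd j]; rfl) (by rw [hKd j]; rfl)
      (by rw [hKi j]; exact fun _ _ => rfl) (fun _ _ => rfl) fun z _ => by
        show (-1) ^ nn j * p j (Fin.init z) / (1 + z (Fin.last 1) ^ 2) = _
        ring
    rw [sub_sub] at h
    have := mk_sub_eq h
    rwa [map_add] at this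
  let RK : Fin l → KZ.IntegralRep 1 := fun j =>
    ⟨T, fun x => p j x * Qk (nn j) (d j), hT, (hp j).mul_holds (sa_Qk hT (hds j) (nn j)), hKQ j⟩
  have eKq : ∀ j, cl (Kq j) = cl (RK j) := fun j =>
    mk_sub_eq (poly_unfold hT (nn j) (hp j) (hds j) (fun _ _ => hd0 j) (Kq j) rfl (fun _ _ => rfl) (RK j) rfl
      fun _ _ => rfl)
  -- (4) the constant-angle fold over `Fin l ⊕ Fin l × Fin 3`
  have hV := constAngleFold hT (ι := Fin l ⊕ Fin l × Fin 3) (Sum.elim d (fun jk : Fin l × Fin 3 => dv jk.1 jk.2))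
    (Sum.elim (fun j x => (-1) ^ (nn j) * p j x) (fun jk x => (cv jk.1 jk.2 : ℝ) * ((-1) ^ (nn jk.1) * p jk.1 x)))
    (Sum.elim Ka (fun jk => V jk.1 jk.2))
    (by rintro (j | ⟨j, k⟩); exacts [hd0 j, hdv0 j k])
    (by rintro (j | ⟨j, k⟩); exacts [hds j, hdvs j k])
    (by
      rintro (j | ⟨j, k⟩)
      · exact hpt j
      · exact IsSemialgebraicFunOn.mul_holds ((saConst_ratCast hT (cv j k : ℚ)).congr fun _ _ => by simp) (hpt j))
    (by rintro (j | ⟨j, k⟩); exacts [rfl, hVd j k])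
    (by
      rintro (j | ⟨j, k⟩)
      · exact fun _ _ => rfl
      · exact hVi j k)
    (fun s => Sum.elim (f' s) (fun jk : Fin l × Fin 3 => cv jk.1 jk.2 * f' s jk.1)) m q' hrel' hbud
    (by
      rintro (j | ⟨j, k⟩) x hx
      · exact hpq j x hx
      · show (cv j k : ℝ) * ((-1) ^ (nn j) * p j x) = ∑ s, q' s x * ((cv j k * f' s j : ℤ) : ℝ)
        rw [hpq j x hx, Finset.mul_sum]
        exact Finset.sum_congr rfl fun s _ => by push_cast; ring)
  have hVsum : ∑ j, cl (Ka j) + ∑ jk : Fin l × Fin 3, cl (V jk.1 jk.2) = 0 := by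
    have := (mk_eq_zero_iff).2 hV
    rw [map_sum, Fintype.sum_sum_type] at this
    exact this
  -- (5) the base reps: `RN = A₀ + Σ_j RK_j + Σ_j R_j` in `Q`
  have hM_int : IntegrableOn (fun x => a₀ x + ∑ j, p j x * Qk (nn j) (d j)) T :=
    ha₀.add (MeasureTheory.integrable_finsetSum _ fun j _ => hKQ j)
  let M : KZ.IntegralRep 1 := ⟨T, fun x => a₀ x + ∑ j, p j x * Qk (nn j) (d j), hT,
    IsSemialgebraicFunOn.add_holds ((hA₀d ▸ A₀.isSemialgebraicFunOn_integrand).congr fun x hx => (hA₀i hx))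
      (KZ.isSemialgebraicFunOn_finset_sum Finset.univ hT fun j _ => (hp j).mul_holds (sa_Qk hT (hds j) (nn j))),
    hM_int⟩
  have r5a : KZ.of RN - KZ.of M - ∑ j, KZ.of (R j) ∈ KZ.relations := by
    refine KZ.of_sub_of_sub_sum_mem_relations l RN M R rfl (fun j => hRd j) fun x hx => ?_
    show ∑ j, ε j * p j x * (Qk (nn j) (d j) - Qk (nn j) (u j x)) =
      (a₀ x + ∑ j, p j x * Qk (nn j) (d j)) + ∑ j, (R j).integrand x
    rw [Finset.sum_congr rfl fun j _ => hRi j hx]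
    have ha : a₀ x = -∑ j, p j x * Qk (nn j) (u j x) := by linarith [hzero x hx]
    rw [ha, ← Finset.sum_neg_distrib, ← Finset.sum_add_distrib, ← Finset.sum_add_distrib]
    refine Finset.sum_congr rfl fun j _ => ?_
    have := hεQ j
    linear_combination (p j x) * this
  have r5b : KZ.of M - KZ.of A₀ - ∑ j, KZ.of (RK j) ∈ KZ.relations := by
    refine KZ.of_sub_of_sub_sum_mem_relations l M A₀ RK hA₀d (fun j => rfl) fun x hx => ?_
    show a₀ x + ∑ j, p j x * Qk (nn j) (d j) = A₀.integrand x + ∑ j, p j x * Qk (nn j) (d j)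
    rw [hA₀i hx]
  have e5 : cl RN = cl A₀ + ∑ j, cl (RK j) + ∑ j, cl (R j) := by
    rw [sub_sub] at r5a r5b
    have ea := mk_sub_eq r5a
    have eb := mk_sub_eq r5b
    rw [map_add, map_sum] at ea eb
    show mk (KZ.of RN) = mk (KZ.of A₀) + ∑ j, mk (KZ.of (RK j)) + ∑ j, mk (KZ.of (R j))
    rw [ea, eb]
  -- (6) assemble in the quotient
  have e1 : ∑ j, cl (A j) = ∑ j, cl (K j) + ∑ jk : Fin l × Fin 3, cl (V jk.1 jk.2) + ∑ j, cl (R j) - ∑ j, cl (W j) := by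
    rw [Finset.sum_congr rfl fun j _ => hclA j, Finset.sum_sub_distrib, Finset.sum_add_distrib, Finset.sum_add_distrib,
      Fintype.sum_prod_type]
  have e2 : ∑ j, cl (K j) = ∑ j, cl (RK j) + ∑ j, cl (Ka j) := by
    rw [← Finset.sum_add_distrib]
    exact Finset.sum_congr rfl fun j _ => by rw [eK j, eKq j]
  have etot : cl A₀ + ∑ j, cl (A j) = 0 := by
    rw [e1, e2, hWt, eN, e5, ← hVsum]
    abel
  apply (mk_eq_zero_iff).1
  rw [map_add, map_sum]
  exact etot

/-! ### §K8 The bottom half-cell by reflection `x ↦ -x`. -/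

/-- Reflection of a circle monomial: `⟦band T 0 u ; p gk⟧ = ⟦band (-T) 0 (u ∘ neg) ; (p ∘ neg) gk⟧` in `𝒫_KZ`. -/
theorem reflect_rep_circ {T : Set (Fin 1 → ℝ)} (hT : IsSemialgebraic ℚ T) (n : ℕ) {p u : (Fin 1 → ℝ) → ℝ}
    (hp : IsSemialgebraicFunOn ℚ T p) (hu : IsSemialgebraicFunOn ℚ T u) (hu0 : ∀ x ∈ T, 0 ≤ u x)
    (A : KZ.IntegralRep 2) (hAd : A.domain = KZlog.band T (fun _ => 0) u)
    (hAi : EqOn A.integrand (fun z => p (Fin.init z) * gk n (z (Fin.last 1))) A.domain)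
    (hint : IntegrableOn (fun x => p x * Gn n (u x)) T) :
    ∃ A' : KZ.IntegralRep 2, A'.domain = KZlog.band {x : Fin 1 → ℝ | -x ∈ T} (fun _ => 0) (fun x => u (-x)) ∧
      A'.integrand = (fun z => p (-Fin.init z) * gk n (z (Fin.last 1))) ∧ cl A = cl A' := by
  have hTm : MeasurableSet T := IsSemialgebraic.measurableSet_holds hT
  have hT's : IsSemialgebraic ℚ {x : Fin 1 → ℝ | -x ∈ T} := isSemialgebraic_reflect hT
  have hp' := sa_comp_neg hp
  have hu' := sa_comp_neg hu
  have hu0' : ∀ x ∈ {x : Fin 1 → ℝ | -x ∈ T}, 0 ≤ u (-x) := fun x hx => hu0 _ hx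
  have hint' : IntegrableOn (fun x => p (-x) * Gn n (u (-x))) {x : Fin 1 → ℝ | -x ∈ T} :=
    (integrableOn_reflect hTm (fun x => p (-x) * Gn n (u (-x)))).2 (by simpa only [neg_neg] using hint)
  let A' : KZ.IntegralRep 2 := circRep hT's hu' hp' n hu0' hint'
  refine ⟨A', rfl, rfl, ?_⟩
  set Φ := flipLin 2 ![-1, 1] with hΦdef
  have hinit : ∀ z : Fin 2 → ℝ, Fin.init (Φ z) = -Fin.init z := fun z => by
    funext i; rw [Subsingleton.elim i 0]; simp only [Fin.init, Pi.neg_apply, hΦdef, flipLin_apply]; simp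
  have hlast : ∀ z : Fin 2 → ℝ, Φ z (Fin.last 1) = z (Fin.last 1) := fun z => by
    rw [hΦdef, flipLin_apply]; simp [show (Fin.last 1 : Fin 2) = 1 from rfl]
  have hinv : ∀ z, Φ (Φ z) = z := fun z => by
    funext i; rw [hΦdef, flipLin_apply, flipLin_apply]
    fin_cases i <;> simp
  have hdet : |Φ.det| = 1 := by rw [hΦdef, det_flipLin]; simp [Fin.prod_univ_two]
  apply mk_sub_eq
  refine KZ.changeOfVariablesRel_subset_relations ⟨2, A, A', Φ, fun _ => Φ, ?_,
    fun z _ => (Φ.hasFDerivAt).hasFDerivWithinAt, ?_, ?_, ?_, rfl⟩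
  · refine (isSemialgebraicMapOn_aeval A.isSemialgebraic_domain
      ![-(MvPolynomial.X 0 : MvPolynomial (Fin 2) ℚ), MvPolynomial.X 1]).congr fun z _ => ?_
    funext i; rw [hΦdef, flipLin_apply]
    fin_cases i <;> simp
  · intro z₁ _ z₂ _ h
    rw [← hinv z₁, ← hinv z₂]; exact congrArg Φ h
  · show KZlog.band {x : Fin 1 → ℝ | -x ∈ T} (fun _ => 0) (fun x => u (-x)) = Φ '' A.domain
    rw [Set.image_eq_preimage_of_inverse hinv hinv, hAd]
    ext w
    simp only [KZlog.mem_band, mem_preimage, mem_setOf_eq, hinit, hlast]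
  · intro z hz
    rw [hAi hz, hdet, mul_one]
    show p (Fin.init z) * gk n (z (Fin.last 1)) = p (-Fin.init (Φ z)) * gk n ((Φ z) (Fin.last 1))
    rw [hinit, hlast, neg_neg]

/-- Reflection of a base rep: `⟦T ; a⟧ = ⟦-T ; a ∘ neg⟧` in `𝒫_KZ`. -/
theorem reflect_rep_base {T : Set (Fin 1 → ℝ)} (hT : IsSemialgebraic ℚ T) {a : (Fin 1 → ℝ) → ℝ}
    (A : KZ.IntegralRep 1) (hAd : A.domain = T) (hAi : EqOn A.integrand a T) :
    ∃ A' : KZ.IntegralRep 1, A'.domain = {x : Fin 1 → ℝ | -x ∈ T} ∧ A'.integrand = (fun x => a (-x)) ∧ cl A = cl A' := by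
  have hTm : MeasurableSet T := IsSemialgebraic.measurableSet_holds hT
  have hT's : IsSemialgebraic ℚ {x : Fin 1 → ℝ | -x ∈ T} := isSemialgebraic_reflect hT
  have ha : IsSemialgebraicFunOn ℚ T a := (hAd ▸ A.isSemialgebraicFunOn_integrand).congr fun x hx => hAi hx
  have haI : IntegrableOn a T := by
    have h := A.integrableOn; rw [hAd] at h; exact h.congr_fun hAi hTm
  have hint' : IntegrableOn (fun x => a (-x)) {x : Fin 1 → ℝ | -x ∈ T} := (integrableOn_reflect hTm (fun x => a (-x))).2
    (by simpa only [neg_neg] using haI)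
  let A' : KZ.IntegralRep 1 := ⟨{x : Fin 1 → ℝ | -x ∈ T}, fun x => a (-x), hT's, sa_comp_neg ha, hint'⟩
  refine ⟨A', rfl, rfl, ?_⟩
  set Φ := flipLin 1 ![-1] with hΦdef
  have hΦ : ∀ x : Fin 1 → ℝ, Φ x = -x := fun x => by
    funext i; rw [Subsingleton.elim i 0, hΦdef, flipLin_apply]; simp
  have hinv : ∀ z, Φ (Φ z) = z := fun z => by rw [hΦ, hΦ, neg_neg]
  have hdet : |Φ.det| = 1 := by rw [hΦdef, det_flipLin]; simp
  apply mk_sub_eq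
  refine KZ.changeOfVariablesRel_subset_relations ⟨1, A, A', Φ, fun _ => Φ, ?_,
    fun z _ => (Φ.hasFDerivAt).hasFDerivWithinAt, ?_, ?_, ?_, rfl⟩
  · refine (isSemialgebraicMapOn_aeval A.isSemialgebraic_domain
      ![-(MvPolynomial.X 0 : MvPolynomial (Fin 1) ℚ)]).congr fun z _ => ?_
    funext i; rw [Subsingleton.elim i 0, hΦ]; simp
  · intro z₁ _ z₂ _ h
    rw [← hinv z₁, ← hinv z₂]; exact congrArg Φ h
  · show {x : Fin 1 → ℝ | -x ∈ T} = Φ '' A.domain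
    rw [Set.image_eq_preimage_of_inverse hinv hinv, hAd]
    ext w
    simp only [mem_preimage, mem_setOf_eq, hΦ]
  · intro z hz
    rw [hAi (hAd ▸ hz), hdet, mul_one]
    show a z = a (-(Φ z))
    rw [hΦ, neg_neg]

end AngleFold
end Summit.KontsevichZagierPeriods.RootDecompRelativeModAbsolute.Rung30571.RegularisedLogLayer.CylLog.Leaf.G13
end
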